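import Summits.QuantumFields.BalabanUV.Beta.EriceFlowEnclosureB12AsPrintedHistoryUniqueMono

/-!
# Beta / EriceFlowEnclosureB12AsPrintedHistoryUniqueModulus — the MODULUS of «g₀ = g₀(ε, g)» in the history reading of [I]: along two
# same-length runs under fading-memory history moduli, the discrepancy in x = 1∕g² at EVERY scale — in particular at the BARE end — is squeezed
# between 0 and twice the discrepancy of the renormalized couplings, UNIFORMLY IN K (β-flow team, prover 1 = recursion ∕ upper ∕ bare-coupling ∕
# uniqueness side, unit `b2b-balaban-beta-bflow-p1`, gen 33; ROW AP-I × ROW U; PARTS `…HistoryUnique` (uniqueness), `…HistoryUniqueMono` (order);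
# companions #22 `…TunedFlow.backward_step_le` ((1 − q)|1∕s − 1∕s′| ≤ |y − y′| per step, Markov x-modulus), #28b `…LimitStabilityRate`)

HONEST FRAMING (page 1 of everything the β sub-cell writes): discharging `BetaPertH` makes Bałaban's UV stability UNCONDITIONAL — a
real constructive-QFT result; it is NOT the continuum limit and NOT the Clay problem.  HONEST DEPENDENCY (cell reorg 2026-08-19,
verbatim): «continuum YM on T⁴ ⇐ BetaPertH ∧ nine spine estimates (0/9 proved); BetaPertH ⇐ (D1) ∧ (D4) ∧ CAP+tail; G-an2-4 gates
asym, D1 and NE2/3/4.»  THIS MODULE DISCHARGES NOTHING: packaging of `…HistoryUniqueMono.sup_disc_le ∕ signed_lower` on the NAMED FIELDS of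
`B12BetaAsPrinted` ([Balaban1987RG1] as typed) under node U2's HYPOTHESIS SHAPES (`HistLipschitz`, `FadingMemory` — NOT printed, p. 298) and
the AF letter (UNPRINTED).  Nothing of Bałaban's objects is asserted.

WHAT THIS FILE PROVES (0 sorry, 0 def):
§15 **`invSq_twoSided_modulus`** (two runs of the same length, couplings in ]0, γ], fading memory, weight sum ≤ U, C·U ≤ (1 − θ)∕2, g_K ≤ g′_K ⟹
    for every j ≤ K: `0 ≤ 1∕g_j² − 1∕g′_j² ≤ 2·(1∕g_K² − 1∕g′_K²)` — the map «renormalized x ↦ x at scale j» is monotone and 2-Lipschitz, UNIFORMLY IN K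
    AND j), `invSq_abs_modulus` (|Δ_j| ≤ 2|Δ_K| without the order hypothesis); on the carrier `bareCoupling_modulus_of_fadingMemory` and the END
    **`theorem2_bareCoupling_modulus`**: under `Theorem2Statement` + `Definitions` + (U) + AF + fading-memory moduli, for small γ, renormalized
    couplings 0 < g ≤ g̃ ≤ g₁ and EVERY K, the tuned bare couplings satisfy `0 ≤ 1∕g₀(ε, g)² − 1∕g₀(ε, g̃)² ≤ 2(1∕g² − 1∕g̃²)`: together with PARTS
    `…HistoryUnique` ∕ `…HistoryUniqueMono`, «g₀ = g₀(ε, g)» is a well-defined, strictly increasing function of g whose inverse-square is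
    2-LIPSCHITZ in 1∕g², uniformly in the cutoff ε = L^{−K} (the history-reading form of row U's cutoff-uniform control, #22∕#28b∕#31).
NOT CLAIMED: any modulus, sign or bound for Bałaban's β; Theorem 2; `BetaPertH`; continuum; Clay.
-/

namespace Summit.QuantumFields.BalabanUV.Beta.EriceFlowEnclosureB12AsPrintedHistoryUniqueModulus

open Finset
open Literature.MathematicalPhysics.QuantumFieldTheory.Balaban1983to89
open Literature.MathematicalPhysics.QuantumFieldTheory.Balaban1983to89.B12BetaAsPrinted
open Literature.MathematicalPhysics.QuantumFieldTheory.Balaban1983to89.FlowStep (prefixOf Box mem_box box_mono RGEqH BetaLowerH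
  BetaUpperH)
open Literature.MathematicalPhysics.QuantumFieldTheory.Balaban1983to89.T4CouplingMatching (HistLipschitz FadingMemory)
open Summit.QuantumFields.BalabanUV.Beta.EriceFlowEnclosureB12AsPrintedUpper (tunedRuns_of_theorem2Statement)
open Summit.QuantumFields.BalabanUV.Beta.EriceFlowEnclosureB12AsPrintedTunedUpper (hrg_of_betaUpperH)
open Summit.QuantumFields.BalabanUV.Beta.EriceFlowEnclosureB12AsPrintedHistoryUnique (sum_weights_le)
open Summit.QuantumFields.BalabanUV.Beta.EriceFlowEnclosureB12AsPrintedHistoryUniqueMono (sup_disc_le signed_lower)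

noncomputable section

variable {S : Setting}

/-! ## §15 The two-sided modulus of the scale-by-scale discrepancy -/

/-- **|Δ_j| ≤ 2|Δ_K| AT EVERY SCALE, UNIFORMLY IN K** (two same-length runs, couplings in ]0, γ], fading-memory moduli, weight sum ≤ U,
C·U ≤ (1 − θ)∕2): `…HistoryUniqueMono.sup_disc_le`, first component. [cite: Balaban1987RG1, Thm 2 p.259 («g₀ = g₀(ε, g)») with (0.20) p.256 and p.298] -/
theorem invSq_abs_modulus {γ θ C U : ℝ} {Λ : ℕ → ℕ → ℝ} {K : ℕ} {g g' : ℕ → ℝ}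
    (hθ0 : 0 < θ) (hθ1 : θ < 1) (hC : 0 ≤ C)
    (hg : RGEqH K S.β g) (hg' : RGEqH K S.β g')
    (hbox : ∀ i, i ≤ K → 0 < g i ∧ g i ≤ γ) (hbox' : ∀ i, i ≤ K → 0 < g' i ∧ g' i ≤ γ)
    (hL : HistLipschitz Λ γ S.β) (hΛ : FadingMemory C θ Λ)
    (hU : ∑ i ∈ range (K + 1), (g i) ^ 2 * g' i ≤ U) (hsmall : C * U ≤ (1 - θ) / 2) {j : ℕ} (hj : j ≤ K) :
    |1 / (g j) ^ 2 - 1 / (g' j) ^ 2| ≤ 2 * |1 / (g K) ^ 2 - 1 / (g' K) ^ 2| :=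
  (sup_disc_le hθ0 hθ1 hC hg hg' hbox hbox' hL hΛ hU hsmall j hj).1

/-- **THE TWO-SIDED MODULUS**: if moreover g_K ≤ g′_K then for every j ≤ K, `0 ≤ 1∕g_j² − 1∕g′_j² ≤ 2·(1∕g_K² − 1∕g′_K²)` — monotone (PART
`…HistoryUniqueMono`) and 2-Lipschitz in the renormalized x = 1∕g², uniformly in K and j. [cite: Balaban1987RG1, Thm 2 p.259 («g₀ = g₀(ε, g)») with (0.20) p.256 and p.298] -/
theorem invSq_twoSided_modulus {γ θ C U : ℝ} {Λ : ℕ → ℕ → ℝ} {K : ℕ} {g g' : ℕ → ℝ}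
    (hθ0 : 0 < θ) (hθ1 : θ < 1) (hC : 0 ≤ C)
    (hg : RGEqH K S.β g) (hg' : RGEqH K S.β g')
    (hbox : ∀ i, i ≤ K → 0 < g i ∧ g i ≤ γ) (hbox' : ∀ i, i ≤ K → 0 < g' i ∧ g' i ≤ γ)
    (hL : HistLipschitz Λ γ S.β) (hΛ : FadingMemory C θ Λ)
    (hU : ∑ i ∈ range (K + 1), (g i) ^ 2 * g' i ≤ U) (hsmall : C * U ≤ (1 - θ) / 2) (hle : g K ≤ g' K) {j : ℕ} (hj : j ≤ K) :
    0 ≤ 1 / (g j) ^ 2 - 1 / (g' j) ^ 2 ∧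
      1 / (g j) ^ 2 - 1 / (g' j) ^ 2 ≤ 2 * (1 / (g K) ^ 2 - 1 / (g' K) ^ 2) := by
  have hK := hbox K le_rfl
  have hΔK : 0 ≤ 1 / (g K) ^ 2 - 1 / (g' K) ^ 2 :=
    sub_nonneg.mpr (one_div_le_one_div_of_le (pow_pos hK.1 2) (pow_le_pow_left₀ hK.1.le hle 2))
  have hlow := signed_lower hθ0 hθ1 hC hg hg' hbox hbox' hL hΛ hU hsmall j hj
  have habs := (sup_disc_le hθ0 hθ1 hC hg hg' hbox hbox' hL hΛ hU hsmall j hj).1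
  rw [abs_of_nonneg hΔK] at hlow habs
  rw [sub_self] at hlow
  exact ⟨hlow, (le_abs_self _).trans habs⟩

/-- **ON THE CARRIER**: for a setting with the printed `Definitions`, two runs (K, m, g₀), (K, m, g₀′) obeying (0.20) inside ]0, γ] with
g_K ≤ g′_K satisfy `0 ≤ 1∕g₀² − 1∕g₀′² ≤ 2(1∕g_K² − 1∕g′_K²)` — under `HistLipschitz` + `FadingMemory`, the AF letter `BetaLowerH b γ S.β` and
C(γ³ + 2γ∕b) ≤ (1 − θ)∕2. [cite: Balaban1987RG1, Thm 2 p.259 («g₀ = g₀(ε, g)») with (0.18)–(0.20) pp.255–256 and p.298] -/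
theorem bareCoupling_modulus_of_fadingMemory (hD : Definitions S) {γ θ C b : ℝ} {Λ : ℕ → ℕ → ℝ}
    (hθ0 : 0 < θ) (hθ1 : θ < 1) (hC : 0 ≤ C) (hγ : 0 < γ) (hb : 0 < b)
    (hL : HistLipschitz Λ γ S.β) (hΛ : FadingMemory C θ Λ) (hlo : BetaLowerH b γ S.β)
    (hsmall : C * (γ ^ 3 + 2 * γ / b) ≤ (1 - θ) / 2) {K m : ℕ} {g₀ g₀' : ℝ}
    (hrg : RGEqH K S.β (S.cpl ⟨K, m, g₀⟩)) (hrg' : RGEqH K S.β (S.cpl ⟨K, m, g₀'⟩))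
    (hI : Step.InInterval γ K (S.cpl ⟨K, m, g₀⟩)) (hI' : Step.InInterval γ K (S.cpl ⟨K, m, g₀'⟩))
    (hle : S.cpl ⟨K, m, g₀⟩ K ≤ S.cpl ⟨K, m, g₀'⟩ K) :
    0 ≤ 1 / g₀ ^ 2 - 1 / g₀' ^ 2 ∧
      1 / g₀ ^ 2 - 1 / g₀' ^ 2 ≤ 2 * (1 / (S.cpl ⟨K, m, g₀⟩ K) ^ 2 - 1 / (S.cpl ⟨K, m, g₀'⟩ K) ^ 2) := by
  have h := invSq_twoSided_modulus hθ0 hθ1 hC hrg hrg' hI hI' hL hΛ (sum_weights_le hγ hb hrg hrg' hI hI' hlo) hsmall hle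
    (Nat.zero_le K)
  rwa [hD.d018, hD.d018] at h

/-- **END — THE MODULUS OF THEOREM 2's «g₀ = g₀(ε, g)» IN THE HISTORY READING.**  With the hypotheses of `…HistoryUnique.theorem2_existsUnique_of_fadingMemory`
(`Theorem2Statement S hL` — a HYPOTHESIS —, printed `Definitions`, (U) with b′γ₁² < 1, AF letter b, `HistLipschitz` + `FadingMemory`, C(γ₁³ + 2γ₁∕b) ≤
(1 − θ)∕2): for every m there is γ₂ > 0 such that for every γ ≤ γ₂ there is g₁ > 0 such that for all renormalized couplings 0 < g ≤ g̃ ≤ g₁ and EVERY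
K, any bare couplings g₀, g̃₀ whose runs stay in ]0, γ] and end at g resp. g̃ satisfy `0 ≤ 1∕g₀² − 1∕g̃₀² ≤ 2(1∕g² − 1∕g̃²)` — the tuned bare
coupling is a monotone function of the renormalized one whose inverse square is 2-LIPSCHITZ in 1∕g², UNIFORMLY IN THE CUTOFF ε = L^{−K}.  A
REDUCTION over UNPRINTED letters; nothing of [I] asserted. [cite: Balaban1987RG1, Thm 2 (0.31) p.259 with (0.20) p.256 and p.298] -/
theorem theorem2_bareCoupling_modulus {hL : Odd S.L ∧ 1 < S.L} (h : Theorem2Statement S hL) (hD : Definitions S)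
    {γu γ₁ b b' θ C : ℝ} {Λ : ℕ → ℕ → ℝ} (hup : BetaUpperH b' γu S.β) (hlo : BetaLowerH b γu S.β) (hb : 0 < b)
    (hL' : HistLipschitz Λ γu S.β) (hΛ : FadingMemory C θ Λ) (hθ0 : 0 < θ) (hθ1 : θ < 1) (hC : 0 ≤ C)
    (hγ₁ : 0 < γ₁) (hγ₁u : γ₁ ≤ γu) (hbu : b' * γ₁ ^ 2 < 1) (hsmall : C * (γ₁ ^ 3 + 2 * γ₁ / b) ≤ (1 - θ) / 2) (m : ℕ) :
    ∃ γ₂ : ℝ, 0 < γ₂ ∧ ∀ γ : ℝ, 0 < γ → γ ≤ γ₂ → ∃ g₁ : ℝ, 0 < g₁ ∧ ∀ g gt : ℝ, 0 < g → g ≤ gt → gt ≤ g₁ → ∀ K : ℕ,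
      (∃ g₀ : ℝ, Step.InInterval γ K (S.cpl ⟨K, m, g₀⟩) ∧ S.cpl ⟨K, m, g₀⟩ K = g) ∧
      ∀ g₀ gt₀ : ℝ, Step.InInterval γ K (S.cpl ⟨K, m, g₀⟩) → S.cpl ⟨K, m, g₀⟩ K = g →
        Step.InInterval γ K (S.cpl ⟨K, m, gt₀⟩) → S.cpl ⟨K, m, gt₀⟩ K = gt →
          0 ≤ 1 / g₀ ^ 2 - 1 / gt₀ ^ 2 ∧ 1 / g₀ ^ 2 - 1 / gt₀ ^ 2 ≤ 2 * (1 / g ^ 2 - 1 / gt ^ 2) := by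
  obtain ⟨γ₀, hγ₀, hγ⟩ := tunedRuns_of_theorem2Statement h m
  refine ⟨min γ₀ γ₁, lt_min hγ₀ hγ₁, fun γ hγpos hγle => ?_⟩
  have hγ₀le : γ ≤ γ₀ := hγle.trans (min_le_left _ _)
  have hγ₁le : γ ≤ γ₁ := hγle.trans (min_le_right _ _)
  have hγule : γ ≤ γu := hγ₁le.trans hγ₁u
  obtain ⟨g₁, hg₁, hg⟩ := hγ γ hγpos hγ₀le
  refine ⟨g₁, hg₁, fun g gt hgpos hle hgtle K => ?_⟩
  have hgle : g ≤ g₁ := hle.trans hgtle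
  obtain ⟨β, β', -, -, hK⟩ := hg g hgpos hgle
  obtain ⟨g₀, hI, hend, -⟩ := hK K
  have hup' : BetaUpperH b' γ S.β := fun k v hv => hup k v (box_mono hγule k hv)
  have hlo' : BetaLowerH b γ S.β := fun k v hv => hlo k v (box_mono hγule k hv)
  have hLγ : HistLipschitz Λ γ S.β := fun k p q hp hq => hL' k p q (box_mono hγule k hp) (box_mono hγule k hq)
  have hγsq : γ ^ 2 ≤ γ₁ ^ 2 := pow_le_pow_left₀ hγpos.le hγ₁le 2
  have hbγ : b' * γ ^ 2 < 1 := by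
    rcases le_or_gt 0 b' with hb' | hb'
    · exact lt_of_le_of_lt (mul_le_mul_of_nonneg_left hγsq hb') hbu
    · nlinarith [sq_nonneg γ]
  have hmono : γ ^ 3 + 2 * γ / b ≤ γ₁ ^ 3 + 2 * γ₁ / b :=
    add_le_add (pow_le_pow_left₀ hγpos.le hγ₁le 3) (div_le_div_of_nonneg_right (by linarith) hb.le)
  have hsmallγ : C * (γ ^ 3 + 2 * γ / b) ≤ (1 - θ) / 2 := (mul_le_mul_of_nonneg_left hmono hC).trans hsmall
  refine ⟨⟨g₀, hI, hend⟩, fun x xt hIx hendx hIxt hendxt => ?_⟩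
  have hm := bareCoupling_modulus_of_fadingMemory hD hθ0 hθ1 hC hγpos hb hLγ hΛ hlo' hsmallγ
    (hrg_of_betaUpperH hD hγpos hup' hbγ ⟨K, m, x⟩ hIx) (hrg_of_betaUpperH hD hγpos hup' hbγ ⟨K, m, xt⟩ hIxt) hIx hIxt
    (by rw [hendx, hendxt]; exact hle)
  rw [hendx, hendxt] at hm
  exact hm

end

end Summit.QuantumFields.BalabanUV.Beta.EriceFlowEnclosureB12AsPrintedHistoryUniqueModulus
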